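import Summits.CriticalPhenomena.PercolationContinuityZ3.Theorems.PercNearOneGluingNoHeavyLowerTailAnchoredRegimeI
import HarnessLib

/-!
# `NoHeavyLowerTail` (stmt-CriticalPhenomena-4575) — the `2 + (any law)` kernel at the LAW level with no regime split: the formal face and `F ≥ 0`
# for EVERY law `ν ≥ 0` from the split rows alone

Support file (prover `prim-cplus-coupling`, gen 17, for the lemma factory `prim-lf-3`; `--supports stmt-CriticalPhenomena-4575`).
No definitions, no named facts, no sorries.  Companion of `…AnchoredRegimeI` / `…KernelTwoPlusStarAnchored`; memos
`run/shared/lean/prim/prim-cplus-coupling/A5-COUPLING-gen17.md`, `run/shared/lean/prim/prim-lf-3/LF3-BETA-R.md` §11, §16a, §19.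

The law-level `2 + (any law)` kernel (prim-lf-3 LF3-BETA-R §11: one 2-port unit with ports `c, d` and hairs `h₁, h₂`, `u = h₁h₂ < 1`, glued with a second
unit of ARBITRARY law `ν ≥ 0` on the subsets of `Q`; core `K` with the observer `o` isolated; witness `j`, target `b`) was in the tree in two regimes:
`twoPlusLaw_regimeI_anchored` (`j ≤ c` in `K_u`, this seat gen 17) and `twoPlusLaw_regimeII_anchored` (`c ≤ j` in `K_u`, prim-lf-3 gen 15).  THIS FILE merges them:

* `face_portRow_anchored`, `twoPlusLaw_portRow_anchored` — the formal face resp. `F ≥ 0` under `hle` (`c ≤ d` in `K`), the rows of `c`, `d` and of a vertex `q`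
  below `j` and below every `Q`-port in `K_u` (`le_total` on the `K_u`-reliabilities of `j` and `c`);
* `twoPlusLaw_anchored_of_le` — the `Q`-row GUARDED: `hrowQ : ∀ q ∈ Q, (q K_u-weakest in Q) → (q ≤_{K_u} j) → row(q) ≥ 0` (if no `Q`-port is below `j`, take
  `q := j` in `…portRow_anchored`, whose row vanishes);
* `twoPlusLaw_anchored` — the same with NO labelling of the two ports (`hle` removed by exchanging `c, d`; every input is symmetric).
So "FACE(ν) ≥ 0 for all laws ν with port rows" (LF3-BETA-R §11a, GL-PORT with a 2-port unit) holds with no ranking hypothesis at all.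
[cite: KozmaNitzan2024, Question 9 (p. 36), Question 7 (p. 36), (41) (p. 36), Thm. 4–5 and Lemma 5 (pp. 12–14), (9) (pp. 9–10)]
-/

namespace Summit.CriticalPhenomena.PercolationContinuityZ3.Theorems

open MeasureTheory Set ProbabilityTheory
open Literature.Probability.LatticeModels
open Literature.Probability.Percolation

noncomputable section
open Classical

namespace UpsetExchange

variable {n : ℕ}

/-- **The formal face, regimes I ∪ II** (no ranking of the witness `j` against the pair): from `hle`, the rows of `c` and `q`, for every law `ν ≥ 0`.
[cite: KozmaNitzan2024, Question 9 (p. 36), Question 7 (p. 36), Lemma 5 (p. 13)] -/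
theorem face_portRow_anchored (K : Sym2 (Fin n) → unitInterval) (o c d q j b : Fin n) (Q : Finset (Fin n))
    (ν : Finset (Fin n) → ℝ) (hν : ∀ S ∈ Q.powerset, 0 ≤ ν S) (u : unitInterval)
    (hoQ : o ∉ Q) (hcQ : c ∉ Q) (hdQ : d ∉ Q) (hbQ : b ∉ Q) (hcd : c ≠ d) (hoc : o ≠ c) (hod : o ≠ d) (hjo : j ≠ o) (hbo : b ≠ o)
    (hisoK : ∀ u' : Fin n, u' ≠ o → K s(o, u') = 0)
    (G : Finset (Fin n) → ℝ)
    (hG : ∀ T : Finset (Fin n), G T =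
      (prodBernoulli (fun f : Sym2 (Fin n) => if f ∈ T.image (fun t => s(o, t)) then 1 else K f)).real (openConn o b) -
        (prodBernoulli (fun f : Sym2 (Fin n) => if f ∈ T.image (fun t => s(o, t)) then 1 else K f)).real (openConn j b))
    (hle : (prodBernoulli K).real (openConn c b) ≤ (prodBernoulli K).real (openConn d b))
    (hcb : c ≠ b) (hdb : d ≠ b) (hjb : j ≠ b) (hcj : c ≠ j) (hdj : d ≠ j) (hjQ : j ∉ Q)
    (hqj : (1 - (u : ℝ)) * (prodBernoulli K).real (openConn q b) +
        (u : ℝ) * (prodBernoulli (fun f : Sym2 (Fin n) => if f = s(c, d) then 1 else K f)).real (openConn q b) ≤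
      (1 - (u : ℝ)) * (prodBernoulli K).real (openConn j b) +
        (u : ℝ) * (prodBernoulli (fun f : Sym2 (Fin n) => if f = s(c, d) then 1 else K f)).real (openConn j b))
    (hqmin : ∀ y ∈ Q, (1 - (u : ℝ)) * (prodBernoulli K).real (openConn q b) +
        (u : ℝ) * (prodBernoulli (fun f : Sym2 (Fin n) => if f = s(c, d) then 1 else K f)).real (openConn q b) ≤
      (1 - (u : ℝ)) * (prodBernoulli K).real (openConn y b) +
        (u : ℝ) * (prodBernoulli (fun f : Sym2 (Fin n) => if f = s(c, d) then 1 else K f)).real (openConn y b))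
    (hrowc : 0 ≤ ∑ S ∈ Q.powerset, ν S *
      ((1 - (u : ℝ)) * ((prodBernoulli (fun e : Sym2 (Fin n) => if (∀ x ∈ e, x ∈ S) ∧ ¬ e.IsDiag then 1 else K e)).real (openConn c b) -
          (prodBernoulli (fun e : Sym2 (Fin n) => if (∀ x ∈ e, x ∈ S) ∧ ¬ e.IsDiag then 1 else K e)).real (openConn j b)) +
        (u : ℝ) * ((prodBernoulli (fun f : Sym2 (Fin n) => if f = s(c, d) then 1 else
              (if (∀ x ∈ f, x ∈ S) ∧ ¬ f.IsDiag then 1 else K f))).real (openConn c b) -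
          (prodBernoulli (fun f : Sym2 (Fin n) => if f = s(c, d) then 1 else
              (if (∀ x ∈ f, x ∈ S) ∧ ¬ f.IsDiag then 1 else K f))).real (openConn j b))))
    (hrowq : 0 ≤ ∑ S ∈ Q.powerset, ν S *
      ((1 - (u : ℝ)) * ((prodBernoulli (fun e : Sym2 (Fin n) => if (∀ x ∈ e, x ∈ S) ∧ ¬ e.IsDiag then 1 else K e)).real (openConn q b) -
          (prodBernoulli (fun e : Sym2 (Fin n) => if (∀ x ∈ e, x ∈ S) ∧ ¬ e.IsDiag then 1 else K e)).real (openConn j b)) +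
        (u : ℝ) * ((prodBernoulli (fun f : Sym2 (Fin n) => if f = s(c, d) then 1 else
              (if (∀ x ∈ f, x ∈ S) ∧ ¬ f.IsDiag then 1 else K f))).real (openConn q b) -
          (prodBernoulli (fun f : Sym2 (Fin n) => if f = s(c, d) then 1 else
              (if (∀ x ∈ f, x ∈ S) ∧ ¬ f.IsDiag then 1 else K f))).real (openConn j b)))) :
    0 ≤ ∑ Y ∈ Q.powerset, ν Y * ((1 - (u : ℝ)) * (if Y = ∅ then 0 else G Y) + (u : ℝ) * G (insert c (insert d Y))) := by
  rcases le_total ((1 - (u : ℝ)) * (prodBernoulli K).real (openConn j b) +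
        (u : ℝ) * (prodBernoulli (fun f : Sym2 (Fin n) => if f = s(c, d) then 1 else K f)).real (openConn j b))
      ((1 - (u : ℝ)) * (prodBernoulli K).real (openConn c b) +
        (u : ℝ) * (prodBernoulli (fun f : Sym2 (Fin n) => if f = s(c, d) then 1 else K f)).real (openConn c b)) with hjcu | hcju
  · exact face_regimeI_anchored K o c d q j b Q ν hν u hoQ hcQ hdQ hbQ hcd hoc hod hjo hbo hisoK G hG hle hcb hdb hjb hcj hdj hjQ hjcu hqj hqmin hrowq
  · exact face_regimeII_anchored K o c d q j b Q ν hν u hoQ hcQ hdQ hbQ hcd hoc hod hjo hbo hisoK G hG hle hcb hdb hjb hcj hdj hjQ hcju hqj hqmin hrowc hrowq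

/-- **The `2 + (any law)` kernel `F ≥ 0`, regimes I ∪ II** (no ranking of `j` against the pair): from `hle`, the rows of `c`, `d`, `q`, for every law `ν ≥ 0`.
[cite: KozmaNitzan2024, Question 9 (p. 36), Question 7 (p. 36), Lemma 5 (p. 13)] -/
theorem twoPlusLaw_portRow_anchored (K : Sym2 (Fin n) → unitInterval) (o c d q j b : Fin n) (Q : Finset (Fin n))
    (ν : Finset (Fin n) → ℝ) (hν : ∀ S ∈ Q.powerset, 0 ≤ ν S) (u : unitInterval) {h₁ h₂ : ℝ}
    (hh₁ : 0 < h₁) (hh₁' : h₁ ≤ 1) (hh₂ : 0 < h₂) (hh₂' : h₂ ≤ 1) (hprod : h₁ * h₂ = u) (hu1 : (u : ℝ) < 1)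
    (hoQ : o ∉ Q) (hcQ : c ∉ Q) (hdQ : d ∉ Q) (hbQ : b ∉ Q) (hcd : c ≠ d) (hoc : o ≠ c) (hod : o ≠ d) (hjo : j ≠ o) (hbo : b ≠ o)
    (hisoK : ∀ u' : Fin n, u' ≠ o → K s(o, u') = 0)
    (G : Finset (Fin n) → ℝ)
    (hG : ∀ T : Finset (Fin n), G T =
      (prodBernoulli (fun f : Sym2 (Fin n) => if f ∈ T.image (fun t => s(o, t)) then 1 else K f)).real (openConn o b) -
        (prodBernoulli (fun f : Sym2 (Fin n) => if f ∈ T.image (fun t => s(o, t)) then 1 else K f)).real (openConn j b))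
    (hle : (prodBernoulli K).real (openConn c b) ≤ (prodBernoulli K).real (openConn d b))
    (hcb : c ≠ b) (hdb : d ≠ b) (hjb : j ≠ b) (hcj : c ≠ j) (hdj : d ≠ j) (hjQ : j ∉ Q)
    (hqj : (1 - (u : ℝ)) * (prodBernoulli K).real (openConn q b) +
        (u : ℝ) * (prodBernoulli (fun f : Sym2 (Fin n) => if f = s(c, d) then 1 else K f)).real (openConn q b) ≤
      (1 - (u : ℝ)) * (prodBernoulli K).real (openConn j b) +
        (u : ℝ) * (prodBernoulli (fun f : Sym2 (Fin n) => if f = s(c, d) then 1 else K f)).real (openConn j b))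
    (hqmin : ∀ y ∈ Q, (1 - (u : ℝ)) * (prodBernoulli K).real (openConn q b) +
        (u : ℝ) * (prodBernoulli (fun f : Sym2 (Fin n) => if f = s(c, d) then 1 else K f)).real (openConn q b) ≤
      (1 - (u : ℝ)) * (prodBernoulli K).real (openConn y b) +
        (u : ℝ) * (prodBernoulli (fun f : Sym2 (Fin n) => if f = s(c, d) then 1 else K f)).real (openConn y b))
    (hrowc : 0 ≤ ∑ S ∈ Q.powerset, ν S *
      ((1 - (u : ℝ)) * ((prodBernoulli (fun e : Sym2 (Fin n) => if (∀ x ∈ e, x ∈ S) ∧ ¬ e.IsDiag then 1 else K e)).real (openConn c b) -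
          (prodBernoulli (fun e : Sym2 (Fin n) => if (∀ x ∈ e, x ∈ S) ∧ ¬ e.IsDiag then 1 else K e)).real (openConn j b)) +
        (u : ℝ) * ((prodBernoulli (fun f : Sym2 (Fin n) => if f = s(c, d) then 1 else
              (if (∀ x ∈ f, x ∈ S) ∧ ¬ f.IsDiag then 1 else K f))).real (openConn c b) -
          (prodBernoulli (fun f : Sym2 (Fin n) => if f = s(c, d) then 1 else
              (if (∀ x ∈ f, x ∈ S) ∧ ¬ f.IsDiag then 1 else K f))).real (openConn j b))))
    (hrowd : 0 ≤ ∑ S ∈ Q.powerset, ν S *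
      ((1 - (u : ℝ)) * ((prodBernoulli (fun e : Sym2 (Fin n) => if (∀ x ∈ e, x ∈ S) ∧ ¬ e.IsDiag then 1 else K e)).real (openConn d b) -
          (prodBernoulli (fun e : Sym2 (Fin n) => if (∀ x ∈ e, x ∈ S) ∧ ¬ e.IsDiag then 1 else K e)).real (openConn j b)) +
        (u : ℝ) * ((prodBernoulli (fun f : Sym2 (Fin n) => if f = s(d, c) then 1 else
              (if (∀ x ∈ f, x ∈ S) ∧ ¬ f.IsDiag then 1 else K f))).real (openConn d b) -
          (prodBernoulli (fun f : Sym2 (Fin n) => if f = s(d, c) then 1 else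
              (if (∀ x ∈ f, x ∈ S) ∧ ¬ f.IsDiag then 1 else K f))).real (openConn j b))))
    (hrowq : 0 ≤ ∑ S ∈ Q.powerset, ν S *
      ((1 - (u : ℝ)) * ((prodBernoulli (fun e : Sym2 (Fin n) => if (∀ x ∈ e, x ∈ S) ∧ ¬ e.IsDiag then 1 else K e)).real (openConn q b) -
          (prodBernoulli (fun e : Sym2 (Fin n) => if (∀ x ∈ e, x ∈ S) ∧ ¬ e.IsDiag then 1 else K e)).real (openConn j b)) +
        (u : ℝ) * ((prodBernoulli (fun f : Sym2 (Fin n) => if f = s(c, d) then 1 else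
              (if (∀ x ∈ f, x ∈ S) ∧ ¬ f.IsDiag then 1 else K f))).real (openConn q b) -
          (prodBernoulli (fun f : Sym2 (Fin n) => if f = s(c, d) then 1 else
              (if (∀ x ∈ f, x ∈ S) ∧ ¬ f.IsDiag then 1 else K f))).real (openConn j b)))) :
    0 ≤ ∑ Y ∈ Q.powerset, ν Y *
        ((1 - h₁) * (1 - h₂) * (if Y = ∅ then 0 else G Y) + (1 - h₁) * h₂ * G (insert d Y) +
          h₁ * (1 - h₂) * G (insert c Y) + h₁ * h₂ * G (insert c (insert d Y))) := by
  rcases le_total ((1 - (u : ℝ)) * (prodBernoulli K).real (openConn j b) +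
        (u : ℝ) * (prodBernoulli (fun f : Sym2 (Fin n) => if f = s(c, d) then 1 else K f)).real (openConn j b))
      ((1 - (u : ℝ)) * (prodBernoulli K).real (openConn c b) +
        (u : ℝ) * (prodBernoulli (fun f : Sym2 (Fin n) => if f = s(c, d) then 1 else K f)).real (openConn c b)) with hjcu | hcju
  · exact twoPlusLaw_regimeI_anchored K o c d q j b Q ν hν u hh₁ hh₁' hh₂ hh₂' hprod hu1 hoQ hcQ hdQ hbQ hcd hoc hod hjo hbo hisoK G hG
      hle hcb hdb hjb hcj hdj hjQ hjcu hqj hqmin hrowc hrowd hrowq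
  · exact twoPlusLaw_regimeII_anchored K o c d q j b Q ν hν u hh₁ hh₁' hh₂ hh₂' hprod hu1 hoQ hcQ hdQ hbQ hcd hoc hod hjo hbo hisoK G hG
      hle hcb hdb hjb hcj hdj hjQ hcju hqj hqmin hrowc hrowd hrowq

/-- **The `2 + (any law)` kernel, ONE THEOREM** (`c` labelled as the `K`-weaker port): rows of `c`, `d`, and the GUARDED row of a `K_u`-weakest `Q`-port
(only if it is below `j` in `K_u`); no other ranking hypothesis.  [cite: KozmaNitzan2024, Question 9 (p. 36), Question 7 (p. 36), Lemma 5 (p. 13)] -/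
theorem twoPlusLaw_anchored_of_le (K : Sym2 (Fin n) → unitInterval) (o c d j b : Fin n) (Q : Finset (Fin n))
    (ν : Finset (Fin n) → ℝ) (hν : ∀ S ∈ Q.powerset, 0 ≤ ν S) (u : unitInterval) {h₁ h₂ : ℝ}
    (hh₁ : 0 < h₁) (hh₁' : h₁ ≤ 1) (hh₂ : 0 < h₂) (hh₂' : h₂ ≤ 1) (hprod : h₁ * h₂ = u) (hu1 : (u : ℝ) < 1)
    (hoQ : o ∉ Q) (hcQ : c ∉ Q) (hdQ : d ∉ Q) (hbQ : b ∉ Q) (hcd : c ≠ d) (hoc : o ≠ c) (hod : o ≠ d) (hjo : j ≠ o) (hbo : b ≠ o)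
    (hisoK : ∀ u' : Fin n, u' ≠ o → K s(o, u') = 0)
    (G : Finset (Fin n) → ℝ)
    (hG : ∀ T : Finset (Fin n), G T =
      (prodBernoulli (fun f : Sym2 (Fin n) => if f ∈ T.image (fun t => s(o, t)) then 1 else K f)).real (openConn o b) -
        (prodBernoulli (fun f : Sym2 (Fin n) => if f ∈ T.image (fun t => s(o, t)) then 1 else K f)).real (openConn j b))
    (hle : (prodBernoulli K).real (openConn c b) ≤ (prodBernoulli K).real (openConn d b))
    (hcb : c ≠ b) (hdb : d ≠ b) (hjb : j ≠ b) (hcj : c ≠ j) (hdj : d ≠ j) (hjQ : j ∉ Q)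
    (hrowc : 0 ≤ ∑ S ∈ Q.powerset, ν S *
      ((1 - (u : ℝ)) * ((prodBernoulli (fun e : Sym2 (Fin n) => if (∀ x ∈ e, x ∈ S) ∧ ¬ e.IsDiag then 1 else K e)).real (openConn c b) -
          (prodBernoulli (fun e : Sym2 (Fin n) => if (∀ x ∈ e, x ∈ S) ∧ ¬ e.IsDiag then 1 else K e)).real (openConn j b)) +
        (u : ℝ) * ((prodBernoulli (fun f : Sym2 (Fin n) => if f = s(c, d) then 1 else
              (if (∀ x ∈ f, x ∈ S) ∧ ¬ f.IsDiag then 1 else K f))).real (openConn c b) -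
          (prodBernoulli (fun f : Sym2 (Fin n) => if f = s(c, d) then 1 else
              (if (∀ x ∈ f, x ∈ S) ∧ ¬ f.IsDiag then 1 else K f))).real (openConn j b))))
    (hrowd : 0 ≤ ∑ S ∈ Q.powerset, ν S *
      ((1 - (u : ℝ)) * ((prodBernoulli (fun e : Sym2 (Fin n) => if (∀ x ∈ e, x ∈ S) ∧ ¬ e.IsDiag then 1 else K e)).real (openConn d b) -
          (prodBernoulli (fun e : Sym2 (Fin n) => if (∀ x ∈ e, x ∈ S) ∧ ¬ e.IsDiag then 1 else K e)).real (openConn j b)) +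
        (u : ℝ) * ((prodBernoulli (fun f : Sym2 (Fin n) => if f = s(d, c) then 1 else
              (if (∀ x ∈ f, x ∈ S) ∧ ¬ f.IsDiag then 1 else K f))).real (openConn d b) -
          (prodBernoulli (fun f : Sym2 (Fin n) => if f = s(d, c) then 1 else
              (if (∀ x ∈ f, x ∈ S) ∧ ¬ f.IsDiag then 1 else K f))).real (openConn j b))))
    (hrowQ : ∀ q ∈ Q,
      (∀ y ∈ Q, (1 - (u : ℝ)) * (prodBernoulli K).real (openConn q b) +
        (u : ℝ) * (prodBernoulli (fun f : Sym2 (Fin n) => if f = s(c, d) then 1 else K f)).real (openConn q b) ≤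
        (1 - (u : ℝ)) * (prodBernoulli K).real (openConn y b) +
        (u : ℝ) * (prodBernoulli (fun f : Sym2 (Fin n) => if f = s(c, d) then 1 else K f)).real (openConn y b)) →
      (1 - (u : ℝ)) * (prodBernoulli K).real (openConn q b) +
        (u : ℝ) * (prodBernoulli (fun f : Sym2 (Fin n) => if f = s(c, d) then 1 else K f)).real (openConn q b) ≤
        (1 - (u : ℝ)) * (prodBernoulli K).real (openConn j b) +
        (u : ℝ) * (prodBernoulli (fun f : Sym2 (Fin n) => if f = s(c, d) then 1 else K f)).real (openConn j b) →
      0 ≤ ∑ S ∈ Q.powerset, ν S *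
        ((1 - (u : ℝ)) * ((prodBernoulli (fun e : Sym2 (Fin n) => if (∀ x ∈ e, x ∈ S) ∧ ¬ e.IsDiag then 1 else K e)).real (openConn q b) -
            (prodBernoulli (fun e : Sym2 (Fin n) => if (∀ x ∈ e, x ∈ S) ∧ ¬ e.IsDiag then 1 else K e)).real (openConn j b)) +
          (u : ℝ) * ((prodBernoulli (fun f : Sym2 (Fin n) => if f = s(c, d) then 1 else
                (if (∀ x ∈ f, x ∈ S) ∧ ¬ f.IsDiag then 1 else K f))).real (openConn q b) -
            (prodBernoulli (fun f : Sym2 (Fin n) => if f = s(c, d) then 1 else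
                (if (∀ x ∈ f, x ∈ S) ∧ ¬ f.IsDiag then 1 else K f))).real (openConn j b)))) :
    0 ≤ ∑ Y ∈ Q.powerset, ν Y *
        ((1 - h₁) * (1 - h₂) * (if Y = ∅ then 0 else G Y) + (1 - h₁) * h₂ * G (insert d Y) +
          h₁ * (1 - h₂) * G (insert c Y) + h₁ * h₂ * G (insert c (insert d Y))) := by
  by_cases hQj : ∃ q ∈ Q, (1 - (u : ℝ)) * (prodBernoulli K).real (openConn q b) +
        (u : ℝ) * (prodBernoulli (fun f : Sym2 (Fin n) => if f = s(c, d) then 1 else K f)).real (openConn q b) ≤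
      (1 - (u : ℝ)) * (prodBernoulli K).real (openConn j b) +
        (u : ℝ) * (prodBernoulli (fun f : Sym2 (Fin n) => if f = s(c, d) then 1 else K f)).real (openConn j b)
  · obtain ⟨q₀, hq₀Q, hq₀j⟩ := hQj
    obtain ⟨q, hqQ, hqmin⟩ := Finset.exists_min_image Q
      (fun y : Fin n => (1 - (u : ℝ)) * (prodBernoulli K).real (openConn y b) +
        (u : ℝ) * (prodBernoulli (fun f : Sym2 (Fin n) => if f = s(c, d) then 1 else K f)).real (openConn y b)) ⟨q₀, hq₀Q⟩
    have hqj := (hqmin q₀ hq₀Q).trans hq₀j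
    exact twoPlusLaw_portRow_anchored K o c d q j b Q ν hν u hh₁ hh₁' hh₂ hh₂' hprod hu1 hoQ hcQ hdQ hbQ hcd hoc hod hjo hbo hisoK G hG
      hle hcb hdb hjb hcj hdj hjQ hqj hqmin hrowc hrowd (hrowQ q hqQ hqmin hqj)
  · have hqmin : ∀ y ∈ Q, (1 - (u : ℝ)) * (prodBernoulli K).real (openConn j b) +
        (u : ℝ) * (prodBernoulli (fun f : Sym2 (Fin n) => if f = s(c, d) then 1 else K f)).real (openConn j b) ≤
        (1 - (u : ℝ)) * (prodBernoulli K).real (openConn y b) +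
        (u : ℝ) * (prodBernoulli (fun f : Sym2 (Fin n) => if f = s(c, d) then 1 else K f)).real (openConn y b) :=
      fun y hy => (lt_of_not_ge fun h => hQj ⟨y, hy, h⟩).le
    have hrowj : 0 ≤ ∑ S ∈ Q.powerset, ν S *
      ((1 - (u : ℝ)) * ((prodBernoulli (fun e : Sym2 (Fin n) => if (∀ x ∈ e, x ∈ S) ∧ ¬ e.IsDiag then 1 else K e)).real (openConn j b) -
          (prodBernoulli (fun e : Sym2 (Fin n) => if (∀ x ∈ e, x ∈ S) ∧ ¬ e.IsDiag then 1 else K e)).real (openConn j b)) +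
        (u : ℝ) * ((prodBernoulli (fun f : Sym2 (Fin n) => if f = s(c, d) then 1 else
              (if (∀ x ∈ f, x ∈ S) ∧ ¬ f.IsDiag then 1 else K f))).real (openConn j b) -
          (prodBernoulli (fun f : Sym2 (Fin n) => if f = s(c, d) then 1 else
              (if (∀ x ∈ f, x ∈ S) ∧ ¬ f.IsDiag then 1 else K f))).real (openConn j b))) := by
      simp only [sub_self, mul_zero, add_zero, Finset.sum_const_zero, le_refl]
    exact twoPlusLaw_portRow_anchored K o c d j j b Q ν hν u hh₁ hh₁' hh₂ hh₂' hprod hu1 hoQ hcQ hdQ hbQ hcd hoc hod hjo hbo hisoK G hG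
      hle hcb hdb hjb hcj hdj hjQ le_rfl hqmin hrowc hrowd hrowj

/-- **The `2 + (any law)` kernel, ONE THEOREM, no labelling of the ports**: as `twoPlusLaw_anchored_of_le` without `hle` (the ports are exchanged
when `d` is the `K`-weaker one).  [cite: KozmaNitzan2024, Question 9 (p. 36), Question 7 (p. 36), Lemma 5 (p. 13)] -/
theorem twoPlusLaw_anchored (K : Sym2 (Fin n) → unitInterval) (o c d j b : Fin n) (Q : Finset (Fin n))
    (ν : Finset (Fin n) → ℝ) (hν : ∀ S ∈ Q.powerset, 0 ≤ ν S) (u : unitInterval) {h₁ h₂ : ℝ}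
    (hh₁ : 0 < h₁) (hh₁' : h₁ ≤ 1) (hh₂ : 0 < h₂) (hh₂' : h₂ ≤ 1) (hprod : h₁ * h₂ = u) (hu1 : (u : ℝ) < 1)
    (hoQ : o ∉ Q) (hcQ : c ∉ Q) (hdQ : d ∉ Q) (hbQ : b ∉ Q) (hcd : c ≠ d) (hoc : o ≠ c) (hod : o ≠ d) (hjo : j ≠ o) (hbo : b ≠ o)
    (hisoK : ∀ u' : Fin n, u' ≠ o → K s(o, u') = 0)
    (G : Finset (Fin n) → ℝ)
    (hG : ∀ T : Finset (Fin n), G T =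
      (prodBernoulli (fun f : Sym2 (Fin n) => if f ∈ T.image (fun t => s(o, t)) then 1 else K f)).real (openConn o b) -
        (prodBernoulli (fun f : Sym2 (Fin n) => if f ∈ T.image (fun t => s(o, t)) then 1 else K f)).real (openConn j b))
    (hcb : c ≠ b) (hdb : d ≠ b) (hjb : j ≠ b) (hcj : c ≠ j) (hdj : d ≠ j) (hjQ : j ∉ Q)
    (hrowc : 0 ≤ ∑ S ∈ Q.powerset, ν S *
      ((1 - (u : ℝ)) * ((prodBernoulli (fun e : Sym2 (Fin n) => if (∀ x ∈ e, x ∈ S) ∧ ¬ e.IsDiag then 1 else K e)).real (openConn c b) -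
          (prodBernoulli (fun e : Sym2 (Fin n) => if (∀ x ∈ e, x ∈ S) ∧ ¬ e.IsDiag then 1 else K e)).real (openConn j b)) +
        (u : ℝ) * ((prodBernoulli (fun f : Sym2 (Fin n) => if f = s(c, d) then 1 else
              (if (∀ x ∈ f, x ∈ S) ∧ ¬ f.IsDiag then 1 else K f))).real (openConn c b) -
          (prodBernoulli (fun f : Sym2 (Fin n) => if f = s(c, d) then 1 else
              (if (∀ x ∈ f, x ∈ S) ∧ ¬ f.IsDiag then 1 else K f))).real (openConn j b))))
    (hrowd : 0 ≤ ∑ S ∈ Q.powerset, ν S *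
      ((1 - (u : ℝ)) * ((prodBernoulli (fun e : Sym2 (Fin n) => if (∀ x ∈ e, x ∈ S) ∧ ¬ e.IsDiag then 1 else K e)).real (openConn d b) -
          (prodBernoulli (fun e : Sym2 (Fin n) => if (∀ x ∈ e, x ∈ S) ∧ ¬ e.IsDiag then 1 else K e)).real (openConn j b)) +
        (u : ℝ) * ((prodBernoulli (fun f : Sym2 (Fin n) => if f = s(d, c) then 1 else
              (if (∀ x ∈ f, x ∈ S) ∧ ¬ f.IsDiag then 1 else K f))).real (openConn d b) -
          (prodBernoulli (fun f : Sym2 (Fin n) => if f = s(d, c) then 1 else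
              (if (∀ x ∈ f, x ∈ S) ∧ ¬ f.IsDiag then 1 else K f))).real (openConn j b))))
    (hrowQ : ∀ q ∈ Q,
      (∀ y ∈ Q, (1 - (u : ℝ)) * (prodBernoulli K).real (openConn q b) +
        (u : ℝ) * (prodBernoulli (fun f : Sym2 (Fin n) => if f = s(c, d) then 1 else K f)).real (openConn q b) ≤
        (1 - (u : ℝ)) * (prodBernoulli K).real (openConn y b) +
        (u : ℝ) * (prodBernoulli (fun f : Sym2 (Fin n) => if f = s(c, d) then 1 else K f)).real (openConn y b)) →
      (1 - (u : ℝ)) * (prodBernoulli K).real (openConn q b) +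
        (u : ℝ) * (prodBernoulli (fun f : Sym2 (Fin n) => if f = s(c, d) then 1 else K f)).real (openConn q b) ≤
        (1 - (u : ℝ)) * (prodBernoulli K).real (openConn j b) +
        (u : ℝ) * (prodBernoulli (fun f : Sym2 (Fin n) => if f = s(c, d) then 1 else K f)).real (openConn j b) →
      0 ≤ ∑ S ∈ Q.powerset, ν S *
        ((1 - (u : ℝ)) * ((prodBernoulli (fun e : Sym2 (Fin n) => if (∀ x ∈ e, x ∈ S) ∧ ¬ e.IsDiag then 1 else K e)).real (openConn q b) -
            (prodBernoulli (fun e : Sym2 (Fin n) => if (∀ x ∈ e, x ∈ S) ∧ ¬ e.IsDiag then 1 else K e)).real (openConn j b)) +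
          (u : ℝ) * ((prodBernoulli (fun f : Sym2 (Fin n) => if f = s(c, d) then 1 else
                (if (∀ x ∈ f, x ∈ S) ∧ ¬ f.IsDiag then 1 else K f))).real (openConn q b) -
            (prodBernoulli (fun f : Sym2 (Fin n) => if f = s(c, d) then 1 else
                (if (∀ x ∈ f, x ∈ S) ∧ ¬ f.IsDiag then 1 else K f))).real (openConn j b)))) :
    0 ≤ ∑ Y ∈ Q.powerset, ν Y *
        ((1 - h₁) * (1 - h₂) * (if Y = ∅ then 0 else G Y) + (1 - h₁) * h₂ * G (insert d Y) +
          h₁ * (1 - h₂) * G (insert c Y) + h₁ * h₂ * G (insert c (insert d Y))) := by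
  rcases le_total ((prodBernoulli K).real (openConn c b)) ((prodBernoulli K).real (openConn d b)) with hle | hle
  · exact twoPlusLaw_anchored_of_le K o c d j b Q ν hν u hh₁ hh₁' hh₂ hh₂' hprod hu1 hoQ hcQ hdQ hbQ hcd hoc hod hjo hbo hisoK G hG
      hle hcb hdb hjb hcj hdj hjQ hrowc hrowd hrowQ
  · have hsw : s(d, c) = s(c, d) := Sym2.eq_swap
    have key := twoPlusLaw_anchored_of_le K o d c j b Q ν hν u hh₂ hh₂' hh₁ hh₁' ((mul_comm _ _).trans hprod) hu1 hoQ hdQ hcQ hbQ hcd.symm hod hoc hjo hbo hisoK G hG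
      hle hdb hcb hjb hdj hcj hjQ hrowd hrowc (by rw [hsw]; exact hrowQ)
    refine le_of_le_of_eq key (Finset.sum_congr rfl fun Y _ => ?_)
    rw [Finset.insert_comm d c Y]
    ring

end UpsetExchange

end

end Summit.CriticalPhenomena.PercolationContinuityZ3.Theorems
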